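import Mathlib.Analysis.SpecialFunctions.Artanh
import Literature.Probability.LatticeModels.GKSInequalities
import HarnessLib

/-!
# Finite-graph witness engine, I: exact Ising spin sums (`gksExpect`) as kernel-decidable rationals

Topic `Literature/Computation/FiniteGraph` (computational infrastructure; everything proved, no facts).
The tree's pair-interaction Ising expectation
`Literature.Probability.LatticeModels.gksExpect Finset.univ K C f` (Friedli–Velenik 2017, §3.8.1) on
the sites `Fin n`, with bonds `C i = {u i, v i}` and couplings `K i`, is a ratio of two finite sums
over the `2^n` spin configurations. When the *bond parameters* `t i = tanh (K i)` are rational, both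
sums are rational after the common factor `∏ cosh (K i)` is cancelled (high-temperature form
`e^{K σσ'} = cosh K (1 + σσ' tanh K)`, Friedli–Velenik eq. (3.44)). This file provides

* `decode`, `sum_spinConfig_eq_sum_range`, `cfgSum` — spin configurations on `Fin n` coded by
  `c < 2^n` (site `i` carries spin `-1` iff bit `i` of `c` is set) and the conversion of `∑ ω` into a
  structurally recursive (binary-split) sum the kernel evaluates (`decide +kernel`) — no `Finset`
  machinery is unfolded and all arithmetic inside the sum is over `ℤ`;
* `bondProdZ`, `monoProdZ`, `isingSumZ`, `isingExpect` — the computable evaluator: for a bond list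
  `[(u, v, a, b), …]` (bond parameter `t = a/b`) and a spin monomial `[x₁, …, x_r]`,
  `isingSumZ n bonds mono = Σ_{c < 2^n} σ_{x₁}⋯σ_{x_r} ∏ (b + a σ_u σ_v) ∈ ℤ` and
  `isingExpect = isingSumZ mono / isingSumZ [] = ⟨σ_{x₁}⋯σ_{x_r}⟩ ∈ ℚ`;
* the BRIDGE `gksExpect_listProd_eq` / `gksExpect_spinAt_mul_spinAt_eq` /
  `gksExpect_spinProduct_eq`: if `C i = {u i, v i}`, `u i ≠ v i` and `tanh (K i) = a i / b i`
  (`a i : ℤ`, `b i : ℕ`, `b i ≠ 0`) then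
  `gksExpect univ K C (σ_{x₁}⋯σ_{x_r}) = isingExpect n (bondsOfFn u v a b) [x₁,…,x_r]` (cast `ℚ → ℝ`);
* `tanh_artanh_div`, `artanh_div_nonneg` — couplings realising given rational bond parameters
  (`K i := Real.artanh (a i / b i)`, ferromagnetic iff `0 ≤ a i`).

Typical use (a refuter's witness against a sign claim on `⟨σ_p σ_q⟩`-matrices): choose
`u v : Fin m → Fin n`, `a : Fin m → ℤ`, `b : Fin m → ℕ` as `![…]` literals, set
`K i := Real.artanh (a i / b i)`,
`C i := {u i, v i}`, rewrite every matrix entry with `gksExpect_spinAt_mul_spinAt_eq`, and close the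
rational identities `isingExpect n [...] [p, q] = a/b` by `decide +kernel` (measured on the farm:
`n = 8`, 9 bonds ≈ 2 s; `n = 12`, 16 bonds: see `IsingCorrelationCert.lean`) or `native_decide`. The companion file `IsingCorrelationCert.lean` packages the whole pipeline
(matrix, certified inverse, sign of an entry) behind one Boolean check. The external generator
(`kit/fgwe/fgwe.py ising …`, compute pool) enumerates graphs, computes the same quantities as
`fmpq_poly`/`fmpq` and prints these Lean literals; it is documentation/tooling, not a dependency.

Design: plain structural recursion on `ℕ` / `List`, no well-founded recursion, no `Finset` in the
computable layer; the proof layer converts once (`sum_spinConfig_eq_sum_range`, by `Fin.consEquiv`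
induction). [folklore] throughout; the model and (3.44) are Friedli–Velenik 2017, §3.7.3–§3.8.1.

## References
* S. Friedli, Y. Velenik, *Statistical Mechanics of Lattice Systems*, CUP 2017, §3.7.3 eq. (3.44),
  §3.8.1 [FriedliVelenik2017].
-/

namespace Literature.Computation.FiniteGraph

open Finset Literature.Probability.LatticeModels

/-! ### Kernel-friendly regrouping of `range` sums -/

/-- A sum over `range (2N)` regrouped in pairs `(2k, 2k+1)`. [folklore] -/
theorem sum_range_two_mul {M : Type*} [AddCommMonoid M] (G : ℕ → M) :
    ∀ N : ℕ, ∑ c ∈ range (2 * N), G c = ∑ k ∈ range N, (G (2 * k) + G (2 * k + 1))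
  | 0 => by simp
  | N + 1 => by
      rw [show 2 * (N + 1) = 2 * N + 1 + 1 by ring, Finset.sum_range_succ, Finset.sum_range_succ,
        sum_range_two_mul G N, Finset.sum_range_succ, add_assoc]

/-! ### Spin configurations coded by natural numbers -/

/-- The spin configuration on `Fin n` coded by `c < 2^n`. [folklore] -/
def decode (n c : ℕ) : SpinConfig (Fin n) := fun i => if c / 2 ^ (i : ℕ) % 2 = 1 then -1 else 1

/-- Bit `0` of `2k + b` is `b` and the higher bits are those of `k`: the decoded configuration of
`2k + b` is `Fin.cons (spin b) (decode n k)`. [folklore] -/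
theorem decode_succ (n k b : ℕ) (hb : b < 2) :
    decode (n + 1) (2 * k + b) = Fin.cons (if b = 1 then -1 else 1) (decode n k) := by
  funext i
  refine Fin.cases ?_ (fun j => ?_) i
  · simp only [decode, Fin.val_zero, pow_zero, Nat.div_one, Fin.cons_zero]
    have : (2 * k + b) % 2 = b := by omega
    rw [this]
  · have h : (2 * k + b) / 2 ^ ((j : ℕ) + 1) = k / 2 ^ (j : ℕ) := by
      rw [pow_succ', ← Nat.div_div_eq_div_mul]
      congr 1
      omega
    simp only [decode, Fin.val_succ, Fin.cons_succ, h]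

/-- `(Finset.univ : Finset ℤˣ) = {1, -1}`. [folklore] -/
theorem univ_unitsInt : (Finset.univ : Finset ℤˣ) = {1, -1} := by decide

/-- **Sum over spin configurations as a sum over codes**: `∑_{ω : Fin n → ℤˣ} F ω =
∑_{c < 2^n} F (decode n c)`. [folklore] -/
theorem sum_spinConfig_eq_sum_range {M : Type*} [AddCommMonoid M] :
    ∀ (n : ℕ) (F : SpinConfig (Fin n) → M), ∑ ω, F ω = ∑ c ∈ range (2 ^ n), F (decode n c)
  | 0, F => by
      rw [Fintype.sum_unique, pow_zero, Finset.sum_range_one]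
      congr 1
      exact Subsingleton.elim _ _
  | n + 1, F => by
      rw [← (Fin.consEquiv fun _ : Fin (n + 1) => ℤˣ).sum_comp F, Fintype.sum_prod_type, univ_unitsInt,
        Finset.sum_insert (by decide), Finset.sum_singleton, pow_succ', sum_range_two_mul,
        Finset.sum_add_distrib, sum_spinConfig_eq_sum_range n, sum_spinConfig_eq_sum_range n]
      congr 1
      · refine Finset.sum_congr rfl fun k _ => ?_
        have h := decode_succ n k 0 (by norm_num)
        rw [add_zero] at h
        rw [h]
        rfl
      · refine Finset.sum_congr rfl fun k _ => ?_
        rw [decode_succ n k 1 (by norm_num)]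
        rfl

/-! ### The high-temperature form of `gksSum` -/

/-- `cosh K + u sinh K = cosh K · (1 + tanh K · u)`. [cite: FriedliVelenik2017, §3.7.3 eq. (3.44)] -/
theorem cosh_add_mul_sinh_eq (K u : ℝ) :
    Real.cosh K + u * Real.sinh K = Real.cosh K * (1 + Real.tanh K * u) := by
  rw [Real.tanh_eq_sinh_div_cosh]
  field_simp [(Real.cosh_pos K).ne']

/-- **High-temperature form of the unnormalised expectation**:
`Z⟨f⟩ = (∏ᵢ cosh Kᵢ) · Σ_{c<2^n} f(ω_c) ∏ᵢ (1 + tanh Kᵢ · (ω_c)_{Cᵢ})`.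
[cite: FriedliVelenik2017, §3.7.3 eq. (3.44) and §3.8.1] -/
theorem gksSum_eq_prod_cosh_mul {ι : Type*} {n : ℕ} (s : Finset ι) (K : ι → ℝ) (C : ι → Finset (Fin n))
    (f : SpinConfig (Fin n) → ℝ) :
    gksSum s K C f = (∏ i ∈ s, Real.cosh (K i)) *
      ∑ c ∈ range (2 ^ n), f (decode n c) * ∏ i ∈ s, (1 + Real.tanh (K i) * spinProduct (C i) (decode n c)) := by
  unfold gksSum
  rw [sum_spinConfig_eq_sum_range, Finset.mul_sum]
  refine Finset.sum_congr rfl fun c _ => ?_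
  rw [gksWeight_eq_prod]
  simp_rw [fun i => cosh_add_mul_sinh_eq (K i) (spinProduct (C i) (decode n c))]
  rw [Finset.prod_mul_distrib]
  ring

/-- **High-temperature form of the expectation**: the `cosh` factors cancel,
`⟨f⟩ = Σ_c f(ω_c) ∏ᵢ (1 + tᵢ (ω_c)_{Cᵢ}) / Σ_c ∏ᵢ (1 + tᵢ (ω_c)_{Cᵢ})`, `tᵢ = tanh Kᵢ`.
[cite: FriedliVelenik2017, §3.8.1] -/
theorem gksExpect_eq_sum_div_sum {ι : Type*} {n : ℕ} (s : Finset ι) (K : ι → ℝ) (C : ι → Finset (Fin n))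
    (f : SpinConfig (Fin n) → ℝ) :
    gksExpect s K C f =
      (∑ c ∈ range (2 ^ n), f (decode n c) * ∏ i ∈ s, (1 + Real.tanh (K i) * spinProduct (C i) (decode n c))) /
        ∑ c ∈ range (2 ^ n), ∏ i ∈ s, (1 + Real.tanh (K i) * spinProduct (C i) (decode n c)) := by
  unfold gksExpect
  rw [gksSum_eq_prod_cosh_mul, gksSum_eq_prod_cosh_mul]
  simp only [one_mul]
  rw [mul_div_mul_left]
  exact (Finset.prod_pos fun i _ => Real.cosh_pos (K i)).ne'

/-! ### The computable evaluator (integer arithmetic, binary-split configuration sum) -/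

/-- `Σ_{j < 2^k} f (c·2^k + j)` by binary splitting on `k` (recursion depth `k`, not `2^k`); the sum
over all configurations of `n` sites is `cfgSum f n 0`. [folklore] -/
def cfgSum (f : ℕ → ℤ) : ℕ → ℕ → ℤ
  | 0, c => f c
  | k + 1, c => cfgSum f k (2 * c) + cfgSum f k (2 * c + 1)

/-- `cfgSum` is a `Finset.range` sum over a dyadic block. [folklore] -/
theorem cfgSum_eq_sum_range (f : ℕ → ℤ) : ∀ k c : ℕ, cfgSum f k c = ∑ j ∈ range (2 ^ k), f (c * 2 ^ k + j)
  | 0, c => by simp [cfgSum]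
  | k + 1, c => by
      rw [cfgSum, cfgSum_eq_sum_range f k, cfgSum_eq_sum_range f k, pow_succ, mul_two, Finset.sum_range_add]
      congr 1
      · refine Finset.sum_congr rfl fun j _ => ?_
        congr 1; ring
      · refine Finset.sum_congr rfl fun j _ => ?_
        congr 1; ring

/-- The sum over all `2^n` configuration codes. [folklore] -/
theorem cfgSum_zero_eq_sum_range (f : ℕ → ℤ) (n : ℕ) : cfgSum f n 0 = ∑ c ∈ range (2 ^ n), f c := by
  rw [cfgSum_eq_sum_range]; simp

/-- The spin (`±1 ∈ ℤ`) of site `i` in the configuration coded by `c`. [folklore] -/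
def spinZ (c i : ℕ) : ℤ := if c / 2 ^ i % 2 = 1 then -1 else 1

/-- A bond datum `(u, v, a, b)`: sites `u, v` and the bond parameter `t = a / b = tanh K`. [folklore] -/
abbrev IsingBond : Type := ℕ × ℕ × ℤ × ℕ

/-- `∏_{(u,v,a,b) ∈ bonds} (b + a σ_u σ_v) ∈ ℤ` in the configuration coded by `c`
(`= (∏ b) · ∏ (1 + t σ_u σ_v)`). [folklore] -/
def bondProdZ (c : ℕ) : List IsingBond → ℤ
  | [] => 1
  | e :: l => ((e.2.2.2 : ℤ) + e.2.2.1 * (spinZ c e.1 * spinZ c e.2.1)) * bondProdZ c l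

/-- The spin monomial `σ_{x₁} ⋯ σ_{x_r} ∈ ℤ` (repetitions allowed) in the configuration coded by `c`. [folklore] -/
def monoProdZ (c : ℕ) : List ℕ → ℤ
  | [] => 1
  | x :: l => spinZ c x * monoProdZ c l

/-- The integer high-temperature sum `Σ_{c < 2^n} σ_mono(c) ∏_{bonds} (b + a σ_u σ_v)`; for
`a/b = tanh K` this is `Z⟨σ_mono⟩ · ∏ b / ∏ cosh K`. [cite: FriedliVelenik2017, §3.8.1] -/
def isingSumZ (n : ℕ) (bonds : List IsingBond) (mono : List ℕ) : ℤ :=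
  cfgSum (fun c => monoProdZ c mono * bondProdZ c bonds) n 0

/-- The rational Ising expectation `⟨σ_mono⟩ = isingSumZ mono / isingSumZ []` of the pair model with
bond parameters `a/b = tanh K` (kernel-decidable: `example : isingExpect 3 [(0,1,3,5),(1,2,3,5),(0,2,3,5)]
[0,1] = 15/19 := by decide +kernel`). [cite: FriedliVelenik2017, §3.8.1] -/
def isingExpect (n : ℕ) (bonds : List IsingBond) (mono : List ℕ) : ℚ :=
  (isingSumZ n bonds mono : ℚ) / (isingSumZ n bonds [] : ℚ)

/-- The bond list of `Fin`-indexed data: sites `u v : Fin m → Fin n`, bond parameters `a i / b i`.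
[folklore] -/
def bondsOfFn {n m : ℕ} (u v : Fin m → Fin n) (a : Fin m → ℤ) (b : Fin m → ℕ) : List IsingBond :=
  List.ofFn fun i => ((u i : ℕ), (v i : ℕ), a i, b i)

/-- `bondProdZ` of `List.ofFn` is the `Fin`-indexed product. [folklore] -/
theorem bondProdZ_ofFn (c : ℕ) : ∀ {m : ℕ} (g : Fin m → IsingBond),
    bondProdZ c (List.ofFn g) = ∏ i, (((g i).2.2.2 : ℤ) + (g i).2.2.1 * (spinZ c (g i).1 * spinZ c (g i).2.1))
  | 0, g => by simp [bondProdZ]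
  | m + 1, g => by rw [List.ofFn_succ, bondProdZ, Fin.prod_univ_succ, bondProdZ_ofFn]

/-- `monoProdZ` is the product of the mapped list. [folklore] -/
theorem monoProdZ_eq_prod (c : ℕ) : ∀ l : List ℕ, monoProdZ c l = (l.map (spinZ c)).prod
  | [] => rfl
  | x :: l => by rw [monoProdZ, List.map_cons, List.prod_cons, monoProdZ_eq_prod c l]

/-- The tree's `spinAt` of a decoded configuration is `spinZ`, cast to `ℝ`. [folklore] -/
theorem spinAt_decode_eq_spinZ (n c : ℕ) (i : Fin n) : spinAt i (decode n c) = ((spinZ c i : ℤ) : ℝ) := by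
  unfold spinAt decode spinZ
  split_ifs <;> simp

/-- The real product of spins of a decoded configuration along a list is `monoProdZ`, cast. [folklore] -/
theorem prod_map_spinAt_decode (n c : ℕ) (xs : List (Fin n)) :
    (xs.map fun x => spinAt x (decode n c)).prod = ((monoProdZ c (xs.map Fin.val) : ℤ) : ℝ) := by
  rw [monoProdZ_eq_prod, List.map_map, Int.cast_list_prod, List.map_map]
  congr 1
  refine List.map_congr_left fun x _ => ?_
  simp [Function.comp, spinAt_decode_eq_spinZ]

/-- For a two-site bond, `ω_{{u,v}} = σ_u σ_v`. [folklore] -/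
theorem spinProduct_pair_decode {n : ℕ} (c : ℕ) {u v : Fin n} (huv : u ≠ v) :
    spinProduct ({u, v} : Finset (Fin n)) (decode n c) = ((spinZ c u * spinZ c v : ℤ) : ℝ) := by
  rw [spinProduct, Finset.prod_pair huv, spinAt_decode_eq_spinZ, spinAt_decode_eq_spinZ, Int.cast_mul]

/-- `b + a s = b (1 + (a/b) s)` for the bond factor (`b ≠ 0`). [folklore] -/
theorem den_add_num_mul {b : ℕ} (hb : b ≠ 0) (a : ℤ) (s : ℝ) :
    (b : ℝ) + (a : ℝ) * s = (b : ℝ) * (1 + (a : ℝ) / (b : ℝ) * s) := by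
  have hd : (b : ℝ) ≠ 0 := by exact_mod_cast hb
  rw [mul_add, mul_one]
  field_simp

/-- **The bridge.** For pair interactions `C i = {u i, v i}` (`u i ≠ v i`) whose bond parameters
`tanh (K i) = a i / b i` are rational (`b i ≠ 0`), the expectation of a product of spins along a list
is the rational `isingExpect`, cast to `ℝ`. [cite: FriedliVelenik2017, §3.8.1] -/
theorem gksExpect_listProd_eq {n m : ℕ} (K : Fin m → ℝ) (C : Fin m → Finset (Fin n))
    (u v : Fin m → Fin n) (a : Fin m → ℤ) (b : Fin m → ℕ) (hC : ∀ i, C i = {u i, v i})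
    (huv : ∀ i, u i ≠ v i) (hb0 : ∀ i, b i ≠ 0) (ht : ∀ i, Real.tanh (K i) = (a i : ℝ) / (b i : ℝ))
    (xs : List (Fin n)) :
    gksExpect Finset.univ K C (fun ω => (xs.map fun x => spinAt x ω).prod) =
      (isingExpect n (bondsOfFn u v a b) (xs.map Fin.val) : ℝ) := by
  -- the common positive factor `D = ∏ b i`
  set D : ℝ := ∏ i : Fin m, (b i : ℝ) with hD
  have hDpos : 0 < D := Finset.prod_pos fun i _ => by
    have := Nat.pos_of_ne_zero (hb0 i); exact_mod_cast this
  have hb : ∀ c, ((bondProdZ c (bondsOfFn u v a b) : ℤ) : ℝ) =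
      D * ∏ i, (1 + Real.tanh (K i) * spinProduct (C i) (decode n c)) := by
    intro c
    rw [bondsOfFn, bondProdZ_ofFn, Int.cast_prod, hD, ← Finset.prod_mul_distrib]
    refine Finset.prod_congr rfl fun i _ => ?_
    rw [hC i, spinProduct_pair_decode c (huv i), ht i]
    push_cast
    rw [den_add_num_mul (hb0 i)]
  rw [gksExpect_eq_sum_div_sum, isingExpect, Rat.cast_div, Rat.cast_intCast, Rat.cast_intCast, isingSumZ,
    isingSumZ, cfgSum_zero_eq_sum_range, cfgSum_zero_eq_sum_range, Int.cast_sum, Int.cast_sum]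
  have hnum : ∑ c ∈ range (2 ^ n), (((monoProdZ c (xs.map Fin.val) * bondProdZ c (bondsOfFn u v a b) : ℤ)) : ℝ) =
      D * ∑ c ∈ range (2 ^ n), (xs.map fun x => spinAt x (decode n c)).prod *
        ∏ i, (1 + Real.tanh (K i) * spinProduct (C i) (decode n c)) := by
    rw [Finset.mul_sum]
    refine Finset.sum_congr rfl fun c _ => ?_
    rw [Int.cast_mul, hb, prod_map_spinAt_decode]
    ring
  have hden : ∑ c ∈ range (2 ^ n), (((monoProdZ c [] * bondProdZ c (bondsOfFn u v a b) : ℤ)) : ℝ) =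
      D * ∑ c ∈ range (2 ^ n), ∏ i, (1 + Real.tanh (K i) * spinProduct (C i) (decode n c)) := by
    rw [Finset.mul_sum]
    refine Finset.sum_congr rfl fun c _ => ?_
    rw [Int.cast_mul, hb, monoProdZ, Int.cast_one, one_mul]
  rw [hnum, hden, mul_div_mul_left _ _ hDpos.ne']

/-- **The bridge for two-point functions** `⟨σ_p σ_q⟩` (the entries of the second-moment matrix of
the spins; `p = q` is allowed and gives `1`). [cite: FriedliVelenik2017, §3.8.1] -/
theorem gksExpect_spinAt_mul_spinAt_eq {n m : ℕ} (K : Fin m → ℝ) (C : Fin m → Finset (Fin n))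
    (u v : Fin m → Fin n) (a : Fin m → ℤ) (b : Fin m → ℕ) (hC : ∀ i, C i = {u i, v i})
    (huv : ∀ i, u i ≠ v i) (hb0 : ∀ i, b i ≠ 0) (ht : ∀ i, Real.tanh (K i) = (a i : ℝ) / (b i : ℝ))
    (p q : Fin n) :
    gksExpect Finset.univ K C (fun ω => spinAt p ω * spinAt q ω) =
      (isingExpect n (bondsOfFn u v a b) [(p : ℕ), (q : ℕ)] : ℝ) := by
  have h := gksExpect_listProd_eq K C u v a b hC huv hb0 ht [p, q]
  simpa using h

/-- **The bridge for `σ_A`** with `A` listed without repetition. [cite: FriedliVelenik2017, §3.8.1] -/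
theorem gksExpect_spinProduct_eq {n m : ℕ} (K : Fin m → ℝ) (C : Fin m → Finset (Fin n))
    (u v : Fin m → Fin n) (a : Fin m → ℤ) (b : Fin m → ℕ) (hC : ∀ i, C i = {u i, v i})
    (huv : ∀ i, u i ≠ v i) (hb0 : ∀ i, b i ≠ 0) (ht : ∀ i, Real.tanh (K i) = (a i : ℝ) / (b i : ℝ))
    (A : Finset (Fin n)) (xs : List (Fin n)) (hxs : xs.Nodup) (hA : A = xs.toFinset) :
    gksExpect Finset.univ K C (spinProduct A) =
      (isingExpect n (bondsOfFn u v a b) (xs.map Fin.val) : ℝ) := by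
  rw [← gksExpect_listProd_eq K C u v a b hC huv hb0 ht xs]
  congr 1
  funext ω
  rw [spinProduct, hA, List.prod_toFinset _ hxs]

/-! ### Couplings with prescribed rational bond parameters -/

/-- `tanh (artanh (a/b)) = a/b` for `|a| < b`: the coupling `K = artanh (a/b)` realises the bond
parameter `a/b`. [folklore] -/
theorem tanh_artanh_div {a : ℤ} {b : ℕ} (h₁ : -(b : ℤ) < a) (h₂ : a < b) :
    Real.tanh (Real.artanh ((a : ℝ) / (b : ℝ))) = (a : ℝ) / (b : ℝ) := by
  have hb : (0 : ℝ) < b := by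
    have : (0 : ℤ) < b := by omega
    exact_mod_cast this
  refine Real.tanh_artanh ⟨?_, ?_⟩
  · rw [lt_div_iff₀ hb, neg_one_mul]; exact_mod_cast h₁
  · rw [div_lt_one hb]; exact_mod_cast h₂

/-- `0 ≤ artanh (a/b)` for `0 ≤ a`: nonnegative bond parameters give ferromagnetic couplings. [folklore] -/
theorem artanh_div_nonneg {a : ℤ} (b : ℕ) (h : 0 ≤ a) : 0 ≤ Real.artanh ((a : ℝ) / (b : ℝ)) :=
  Real.artanh_nonneg (div_nonneg (by exact_mod_cast h) (Nat.cast_nonneg b))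

/-- The card-two condition of the pair model. [folklore] -/
theorem card_pair_eq_two {n : ℕ} {u v : Fin n} (huv : u ≠ v) : ({u, v} : Finset (Fin n)).card = 2 :=
  Finset.card_pair huv

/-! ### Kernel regression examples (cheap; the `n = 12`, 16-bond analogue takes ≈ 20 s and is not kept) -/

/-- Triangle, all bond parameters `3/5`: `⟨σ₀σ₁⟩ = (t + t²)/(1 + t³) = 15/19`. -/
example : isingExpect 3 [(0, 1, 3, 5), (1, 2, 3, 5), (0, 2, 3, 5)] [0, 1] = 15 / 19 := by
  decide +kernel

/-- An `8`-cycle with a chord (`t = 3/5` on the cycle, `1/3` on the chord): `⟨σ₀σ₃⟩ = 24565/53867`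
(≈ 2 s in the kernel). -/
example : isingExpect 8 [(0, 1, 3, 5), (1, 2, 3, 5), (2, 3, 3, 5), (3, 4, 3, 5), (4, 5, 3, 5), (5, 6, 3, 5),
    (6, 7, 3, 5), (7, 0, 3, 5), (0, 4, 1, 3)] [0, 3] = 24565 / 53867 := by
  decide +kernel

end Literature.Computation.FiniteGraph
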